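import Mathlib
import Summits.Ventures.PercRepro2.StarIdentities
import Summits.Ventures.PercRepro2.TypedPendantRootSeries

/-!
# The pendant root at a degree-three star: the `(1,1)`-root identity `N₂ = N₁ + N₃`
(blind cell PercRepro2, mine-2 g51, 2026-08-29; `conjectures/MINE-2.md` M2-108 add. 1)

For the root `a₁` a leaf at `f = {a₁, u}` (`u` unmarked) with `N_k := typedCount F z (τ[f := k]) K₃`,
suppose `u` carries exactly TWO further typed edges `e₁ = {u, v₁}`, `e₂ = {u, v₂}`, both of class
`1` (every other edge at `u` a loop or pinned closed — p1's `StarData` for the star `(f, e₁, e₂)` at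
`y = u`).  p1's degree-three star identities `star_111` / `star_211` (`StarIdentities.lean`) express
`N₁` and `N₂` through the pattern counts `B(∅)`, `B(P₁)` of the star; at a pendant ROOT two of
them vanish — `B(∅)` (the root untouched, `typedCount_eq_zero_of_untouched_a1`) and `B(23₁)` (the
two far edges open together in one copy, the root edge closed everywhere: the type-`0` split of
`N₀ = 0`, `typedCount_pendant_root_zero`) — and the two identities collapse to

* **`pendant_root_one_one`**: `N₂ = N₁ + N₃` at every `(1,1)`-root.

Hence (**`pmRoot_one_one_iff`**, **`upper_one_one_iff`**) at such a root the whole pendant-root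
cone `N₃ ≤ N₂/2 ≤ N₁` of (PM-ROOT) (M2-107 add. 1) is the SINGLE inequality `N₃ ≤ N₁` — the
contracted base is at most the type-`1` base; the same identity holds at a class-`2` series root
(**`pendant_root_series_two_sum`**, from `pendant_root_series_two`).  Census (own code,
data/mine-2/g51): `N₂ = N₁ + N₃` on 26,014 / 26,014 (5-vertex, ≤ 7 edges) and 18,641 / 18,641
(6-vertex sample) `(1,1)`-root class vectors; the placement calculus shows no linear identity at
the root types `(1,2)`, `(2,2)` and the degree-four roots.  Own work; standard axioms; nothing here
asserts a candidate.
-/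

namespace Summit.Ventures.PercRepro2

open CovForm CovForm.OneTyped CovForm.TypedRed CovForm.Untouched StarPattern

namespace CovForm

namespace TypedRed

/-! ## Pattern counts do not see the type of an edge off `F₀` -/

section Congr

variable {V : Type*} {E : Type*} [Fintype E] [DecidableEq E] {R : Type*} [Field R]
variable (ends : E → Sym2 V) (o a₁ a₂ a₃ b : V) (s₁ s₂ s₃ : E)

/-- A pattern count only sees the types on `F₀`. -/
lemma patCount_update_τ {F₀ : Finset E} {g : E} (hg : g ∉ F₀) (z₀ : Config E) (τ : E → ℕ)
    (k : ℕ) (U₀ U₁ U₂ : Bool × Bool × Bool) :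
    patCount (R := R) ends o a₁ a₂ a₃ b s₁ s₂ s₃ F₀ z₀ (Function.update τ g k) U₀ U₁ U₂ =
      patCount ends o a₁ a₂ a₃ b s₁ s₂ s₃ F₀ z₀ τ U₀ U₁ U₂ := by
  unfold patCount
  exact typedCount_congr_τ F₀ z₀ (fun e he => Function.update_of_ne (fun h => hg (by rw [← h]; exact he)) k τ) _

/-- `B(P₁)` only sees the types on `F₀`. -/
lemma Bone_update_τ {F₀ : Finset E} {g : E} (hg : g ∉ F₀) (z₀ : Config E) (τ : E → ℕ) (k : ℕ)
    (P : Bool × Bool × Bool) :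
    Bone (R := R) ends o a₁ a₂ a₃ b s₁ s₂ s₃ F₀ z₀ (Function.update τ g k) P =
      Bone ends o a₁ a₂ a₃ b s₁ s₂ s₃ F₀ z₀ τ P := by
  unfold Bone
  simp only [patCount_update_τ ends o a₁ a₂ a₃ b s₁ s₂ s₃ hg]

/-- `B(∅)` only sees the types on `F₀`. -/
lemma Bempty_update_τ {F₀ : Finset E} {g : E} (hg : g ∉ F₀) (z₀ : Config E) (τ : E → ℕ) (k : ℕ) :
    Bempty (R := R) ends o a₁ a₂ a₃ b s₁ s₂ s₃ F₀ z₀ (Function.update τ g k) =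
      Bempty ends o a₁ a₂ a₃ b s₁ s₂ s₃ F₀ z₀ τ := by
  unfold Bempty
  exact patCount_update_τ ends o a₁ a₂ a₃ b s₁ s₂ s₃ hg z₀ τ k _ _ _

end Congr

/-! ## The two vanishing pattern counts at a pendant root -/

section Vanish

open Classical

variable {V : Type*} {E : Type*} [Fintype E] [DecidableEq E] {R : Type*} [Field R]
  [LinearOrder R] [IsStrictOrderedRing R]
variable (ends : E → Sym2 V) (o a₁ a₂ a₃ b : V)

/-- **`B(∅) = 0` at a pendant root**: the closed-star base has the root untouched. -/
theorem Bempty_pendant_root_eq_zero {f e₁ e₂ : E} (hleaf : ∀ e, a₁ ∈ ends e → e = f) {u v₁ v₂ : V}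
    (F : Finset E) (z : Config E) (τ : E → ℕ)
    (D : StarData ends o a₁ a₂ a₃ b f e₁ e₂ u a₁ v₁ v₂ (((F.erase f).erase e₁).erase e₂)
      (Function.update (Function.update (Function.update z f false) e₁ false) e₂ false))
    (hτ : ∀ e ∈ F, τ e = 1 ∨ τ e = 2) :
    Bempty (R := R) ends o a₁ a₂ a₃ b f e₁ e₂ (((F.erase f).erase e₁).erase e₂)
      (Function.update (Function.update (Function.update z f false) e₁ false) e₂ false) τ = 0 := by
  set F₀ := ((F.erase f).erase e₁).erase e₂ with hF₀
  set z₀ := Function.update (Function.update (Function.update z f false) e₁ false) e₂ false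
    with hz₀
  have hzf : z₀ f = false := by
    rw [hz₀, Function.update_of_ne D.h13, Function.update_of_ne D.h12, Function.update_self]
  have hz1 : z₀ e₁ = false := by
    rw [hz₀, Function.update_of_ne D.h23, Function.update_self]
  have hz2 : z₀ e₂ = false := by
    rw [hz₀, Function.update_self]
  unfold Bempty patCount patKernel
  have hK : typedCount F₀ z₀ τ (fun x y w => (K3 ends o a₁ a₂ a₃ b : Config E → Config E → Config E → R)
      (starSet f e₁ e₂ (false, false, false) x) (starSet f e₁ e₂ (false, false, false) y)
      (starSet f e₁ e₂ (false, false, false) w)) = typedCount F₀ z₀ τ (K3 ends o a₁ a₂ a₃ b) := by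
    refine typedCount_congr_K_on _ _ _ fun x y w hxyw _ => ?_
    have hs : ∀ v : Config E, (∀ e, e ∉ F₀ → v e = z₀ e) → starSet f e₁ e₂ (false, false, false) v = v := by
      intro v hv
      unfold starSet
      have h2 : Function.update v e₂ false = v := by
        rw [← hz2, ← hv e₂ D.hF₃]; exact Function.update_eq_self e₂ v
      have h1 : Function.update v e₁ false = v := by
        rw [← hz1, ← hv e₁ D.hF₂]; exact Function.update_eq_self e₁ v
      have h0 : Function.update v f false = v := by
        rw [← hzf, ← hv f D.hF₁]; exact Function.update_eq_self f v
      simp only [h2, h1, h0]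
    rw [hs x fun e he => (hxyw e he).1, hs y fun e he => (hxyw e he).2.1,
      hs w fun e he => (hxyw e he).2.2]
  rw [hK]
  exact typedCount_eq_zero_of_untouched_a1 ends o a₁ a₂ a₃ b F₀ z₀ τ
    (fun e he => hτ e (Finset.mem_of_mem_erase (Finset.mem_of_mem_erase (Finset.mem_of_mem_erase he))))
    (untouchedBy_leaf_closed ends a₁ hleaf F₀ D.hF₁ z₀ hzf)

omit [LinearOrder R] [IsStrictOrderedRing R] in
/-- **The type-`0` star split at a pendant root**: with the root edge of class `0` and the two far
edges of class `1`, `N₀ = B(23₁) + 6 · B(∅)` (the six mixed placements close to the empty star). -/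
theorem typedCount_pendant_root_star_zero {f e₁ e₂ : E} {u v₁ v₂ : V} (F : Finset E) (z : Config E)
    (τ : E → ℕ)
    (D : StarData ends o a₁ a₂ a₃ b f e₁ e₂ u a₁ v₁ v₂ (((F.erase f).erase e₁).erase e₂)
      (Function.update (Function.update (Function.update z f false) e₁ false) e₂ false))
    (hfF : f ∈ F) (he₁ : e₁ ∈ F) (he₂ : e₂ ∈ F) (hτ₁ : τ e₁ = 1) (hτ₂ : τ e₂ = 1) :
    typedCount F z (Function.update τ f 0)
        (K3 ends o a₁ a₂ a₃ b : Config E → Config E → Config E → R) =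
      Bone ends o a₁ a₂ a₃ b f e₁ e₂ (((F.erase f).erase e₁).erase e₂)
          (Function.update (Function.update (Function.update z f false) e₁ false) e₂ false) τ
          (false, true, true) +
        6 * Bempty ends o a₁ a₂ a₃ b f e₁ e₂ (((F.erase f).erase e₁).erase e₂)
          (Function.update (Function.update (Function.update z f false) e₁ false) e₂ false) τ := by
  have he₁' : e₁ ∈ F.erase f := Finset.mem_erase.mpr ⟨D.h12.symm, he₁⟩
  have he₂' : e₂ ∈ (F.erase f).erase e₁ :=
    Finset.mem_erase.mpr ⟨D.h23.symm, Finset.mem_erase.mpr ⟨D.h13.symm, he₂⟩⟩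
  have hsplit : typedCount F z (Function.update τ f 0)
      (K3 ends o a₁ a₂ a₃ b : Config E → Config E → Config E → R) =
      ∑ p₂ ∈ placements, ∑ p₃ ∈ placements,
        patCount ends o a₁ a₂ a₃ b f e₁ e₂ (((F.erase f).erase e₁).erase e₂)
          (Function.update (Function.update (Function.update z f false) e₁ false) e₂ false) τ
          (false, p₂.1, p₃.1) (false, p₂.2.1, p₃.2.1) (false, p₂.2.2, p₃.2.2) := by
    rw [typedCount_split_zero F f hfF]
    simp only [typedCount_split (F.erase f) e₁ he₁', hτ₁, sum_bool3_one]
    simp only [typedCount_split ((F.erase f).erase e₁) e₂ he₂', hτ₂, sum_bool3_one]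
    simp only [sum_placements]
    unfold patCount patKernel starSet
    simp only []
  rw [hsplit]
  simp only [sum_placements]
  simp only [patCount_close_x D τ (Or.inr (Or.inl rfl)), patCount_close_x D τ (Or.inr (Or.inr rfl)),
    patCount_close_y D τ _ (Or.inr (Or.inl rfl)), patCount_close_y D τ _ (Or.inr (Or.inr rfl)),
    patCount_close_w D τ _ _ (Or.inr (Or.inl rfl)), patCount_close_w D τ _ _ (Or.inr (Or.inr rfl))]
  unfold Bempty Bone
  ring

/-- **`B(23₁) = 0` at a pendant root**: the two far edges open together in one copy with the root
edge closed everywhere count nothing (`N₀ = 0` and `B(∅) = 0`). -/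
theorem Bone_far_pendant_root_eq_zero {f e₁ e₂ : E} (hleaf : ∀ e, a₁ ∈ ends e → e = f) {u v₁ v₂ : V}
    (F : Finset E) (z : Config E) (τ : E → ℕ)
    (D : StarData ends o a₁ a₂ a₃ b f e₁ e₂ u a₁ v₁ v₂ (((F.erase f).erase e₁).erase e₂)
      (Function.update (Function.update (Function.update z f false) e₁ false) e₂ false))
    (hfF : f ∈ F) (he₁ : e₁ ∈ F) (he₂ : e₂ ∈ F) (hτ : ∀ e ∈ F, τ e = 1 ∨ τ e = 2) (hτ₁ : τ e₁ = 1)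
    (hτ₂ : τ e₂ = 1) :
    Bone (R := R) ends o a₁ a₂ a₃ b f e₁ e₂ (((F.erase f).erase e₁).erase e₂)
      (Function.update (Function.update (Function.update z f false) e₁ false) e₂ false) τ
      (false, true, true) = 0 := by
  have h0 := typedCount_pendant_root_star_zero (R := R) ends o a₁ a₂ a₃ b F z τ D hfF he₁ he₂ hτ₁ hτ₂
  rw [typedCount_pendant_root_zero ends o a₁ a₂ a₃ b hleaf F hfF z τ hτ,
    Bempty_pendant_root_eq_zero ends o a₁ a₂ a₃ b hleaf F z τ D hτ] at h0
  linarith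

end Vanish

/-! ## The `(1,1)`-root identity -/

section Identity

open Classical

variable {V : Type*} {E : Type*} [Fintype E] [DecidableEq E] {R : Type*} [Field R]
  [LinearOrder R] [IsStrictOrderedRing R]
variable (ends : E → Sym2 V) (o a₁ a₂ a₃ b : V)

/-- **The `(1,1)`-root identity**: at a pendant root whose attachment vertex carries exactly two
further typed edges, both of class `1`, `N₂ = N₁ + N₃` (p1's `star_111` and `star_211` with
`B(∅) = B(23₁) = 0`). -/
theorem pendant_root_one_one {f e₁ e₂ : E} (hleaf : ∀ e, a₁ ∈ ends e → e = f) {u v₁ v₂ : V}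
    (F : Finset E) (z : Config E) (τ : E → ℕ)
    (D : StarData ends o a₁ a₂ a₃ b f e₁ e₂ u a₁ v₁ v₂ (((F.erase f).erase e₁).erase e₂)
      (Function.update (Function.update (Function.update z f false) e₁ false) e₂ false))
    (hfF : f ∈ F) (he₁ : e₁ ∈ F) (he₂ : e₂ ∈ F) (hτ : ∀ e ∈ F, τ e = 1 ∨ τ e = 2) (hτ₁ : τ e₁ = 1)
    (hτ₂ : τ e₂ = 1) :
    typedCount F z (Function.update τ f 2)
        (K3 ends o a₁ a₂ a₃ b : Config E → Config E → Config E → R) =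
      typedCount F z (Function.update τ f 1) (K3 ends o a₁ a₂ a₃ b) +
        typedCount F z (Function.update τ f 3) (K3 ends o a₁ a₂ a₃ b) := by
  have hfF₀ : f ∉ ((F.erase f).erase e₁).erase e₂ := D.hF₁
  have hτ₁' : ∀ k : ℕ, Function.update τ f k e₁ = 1 := fun k => by
    rw [Function.update_of_ne D.h12.symm]; exact hτ₁
  have hτ₂' : ∀ k : ℕ, Function.update τ f k e₂ = 1 := fun k => by
    rw [Function.update_of_ne D.h13.symm]; exact hτ₂
  have h1 := star_111 (R := R) F z (Function.update τ f 1) D hfF he₁ he₂ (Function.update_self f 1 τ)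
    (hτ₁' 1) (hτ₂' 1)
  have h2 := star_211 (R := R) F z (Function.update τ f 2) D hfF he₁ he₂ (Function.update_self f 2 τ)
    (hτ₁' 2) (hτ₂' 2)
  rw [Function.update_idem] at h2
  simp only [Bone_update_τ ends o a₁ a₂ a₃ b f e₁ e₂ hfF₀, Bempty_update_τ ends o a₁ a₂ a₃ b f e₁ e₂ hfF₀]
    at h1 h2
  rw [Bempty_pendant_root_eq_zero ends o a₁ a₂ a₃ b hleaf F z τ D hτ] at h1
  rw [Bone_far_pendant_root_eq_zero ends o a₁ a₂ a₃ b hleaf F z τ D hfF he₁ he₂ hτ hτ₁ hτ₂] at h1 h2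
  rw [h1, h2]
  ring

/-- **At a `(1,1)`-root the two lower bounds of (PM-ROOT) are the single inequality `N₃ ≤ N₁`.** -/
theorem pmRoot_one_one_iff {f e₁ e₂ : E} (hleaf : ∀ e, a₁ ∈ ends e → e = f) {u v₁ v₂ : V}
    (F : Finset E) (z : Config E) (τ : E → ℕ)
    (D : StarData ends o a₁ a₂ a₃ b f e₁ e₂ u a₁ v₁ v₂ (((F.erase f).erase e₁).erase e₂)
      (Function.update (Function.update (Function.update z f false) e₁ false) e₂ false))
    (hfF : f ∈ F) (he₁ : e₁ ∈ F) (he₂ : e₂ ∈ F) (hτ : ∀ e ∈ F, τ e = 1 ∨ τ e = 2) (hτ₁ : τ e₁ = 1)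
    (hτ₂ : τ e₂ = 1) :
    (typedCount F z (Function.update τ f 3)
          (K3 ends o a₁ a₂ a₃ b : Config E → Config E → Config E → R) ≤
        typedCount F z (Function.update τ f 1) (K3 ends o a₁ a₂ a₃ b) ∧
      2 * typedCount F z (Function.update τ f 3)
          (K3 ends o a₁ a₂ a₃ b : Config E → Config E → Config E → R) ≤
        typedCount F z (Function.update τ f 2) (K3 ends o a₁ a₂ a₃ b)) ↔
      typedCount F z (Function.update τ f 3)
          (K3 ends o a₁ a₂ a₃ b : Config E → Config E → Config E → R) ≤
        typedCount F z (Function.update τ f 1) (K3 ends o a₁ a₂ a₃ b) := by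
  rw [pendant_root_one_one ends o a₁ a₂ a₃ b hleaf F z τ D hfF he₁ he₂ hτ hτ₁ hτ₂]
  constructor
  · rintro ⟨h, -⟩; exact h
  · intro h; exact ⟨h, by linarith⟩

/-- **At a `(1,1)`-root the upper bound `N₂ ≤ 2·N₁` is the same inequality `N₃ ≤ N₁`.** -/
theorem upper_one_one_iff {f e₁ e₂ : E} (hleaf : ∀ e, a₁ ∈ ends e → e = f) {u v₁ v₂ : V}
    (F : Finset E) (z : Config E) (τ : E → ℕ)
    (D : StarData ends o a₁ a₂ a₃ b f e₁ e₂ u a₁ v₁ v₂ (((F.erase f).erase e₁).erase e₂)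
      (Function.update (Function.update (Function.update z f false) e₁ false) e₂ false))
    (hfF : f ∈ F) (he₁ : e₁ ∈ F) (he₂ : e₂ ∈ F) (hτ : ∀ e ∈ F, τ e = 1 ∨ τ e = 2) (hτ₁ : τ e₁ = 1)
    (hτ₂ : τ e₂ = 1) :
    typedCount F z (Function.update τ f 2)
          (K3 ends o a₁ a₂ a₃ b : Config E → Config E → Config E → R) ≤
        2 * typedCount F z (Function.update τ f 1) (K3 ends o a₁ a₂ a₃ b) ↔
      typedCount F z (Function.update τ f 3)
          (K3 ends o a₁ a₂ a₃ b : Config E → Config E → Config E → R) ≤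
        typedCount F z (Function.update τ f 1) (K3 ends o a₁ a₂ a₃ b) := by
  rw [pendant_root_one_one ends o a₁ a₂ a₃ b hleaf F z τ D hfF he₁ he₂ hτ hτ₁ hτ₂]
  constructor <;> intro h <;> linarith

/-- **The same identity at a class-`2` series root**: `N₂ = N₁ + N₃` (from `pendant_root_series_two`). -/
theorem pendant_root_series_two_sum {f e : E} (hef : e ≠ f) {u v : V} (hf : ends f = s(a₁, u))
    (hleaf : ∀ e', a₁ ∈ ends e' → e' = f) (he : ends e = s(u, v)) (hu1 : u ≠ a₁) (huv : u ≠ v)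
    (huo : u ≠ o) (hu2 : u ≠ a₂) (hu3 : u ≠ a₃) (hub : u ≠ b) (F : Finset E) (hfF : f ∈ F)
    (heF : e ∈ F) (z : Config E) (τ : E → ℕ) (hτ : ∀ e' ∈ F, τ e' = 1 ∨ τ e' = 2) (hτe : τ e = 2)
    (hcl : ∀ e', e' ≠ f → e' ≠ e → u ∈ ends e' → e' ∉ F ∧ z e' = false) :
    typedCount F z (Function.update τ f 2)
        (K3 ends o a₁ a₂ a₃ b : Config E → Config E → Config E → R) =
      typedCount F z (Function.update τ f 1) (K3 ends o a₁ a₂ a₃ b) +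
        typedCount F z (Function.update τ f 3) (K3 ends o a₁ a₂ a₃ b) := by
  obtain ⟨h1, h2, h3⟩ := pendant_root_series_two (R := R) ends o a₁ a₂ a₃ b hef hf hleaf he hu1 huv
    huo hu2 hu3 hub F hfF heF z τ hτ hτe hcl
  rw [h1, h2, h3]
  ring

end Identity

end TypedRed

end CovForm

end Summit.Ventures.PercRepro2
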